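import Literature.Computability.Complexity.Completeness
import Literature.Computability.Learning.SizeClassCounting
import Literature.Computability.MetaComplexity.MCSP
import HarnessLib

/-!
# Hirahara's reduction: the partial truth table and the `MCSP*` instance

Topic `Computability/Complexity`. The output of Hirahara's reduction from CMMSA to `MCSP*`
(ECCC TR22-119, proof of Thm. 8.5, `MCSP*` case, p. 31: "the truth table of E_k … a partial function
`f : {0,1}^{O(log n)} → {0,1,*}`", with the sample of the proof of Lemma 8.3): the partial function
`PT` on the `Lx = Lj + d + mm·Δ` index bits that carries the secret `b` at (the bits of) every sample
point `(j, z, NW ⊕ Share(φⱼ, b; r))` and `*` elsewhere, its code as an `MCSP*` instance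
(`HiraharaRed.tableCode`), and the two bridges used by the final assembly:

* `HiraharaRed.PT_xbits_point` — the table is well defined: a sample point determines its secret
  (injectivity of the index bits and Benaloh–Leichter reconstruction with all parties);
* `HiraharaRed.tableCode_mem_MCSPStar_iff` — `tableCode ∈ MCSP*` iff some `B₂`-circuit with at
  most `s_P` gates answers `b` at every sample point;
* `HiraharaRed.tests`, `card_tests_le`, `exists_mem_tests_of_circuit` — the functions of the sample
  index computed by such circuits form a family of at most `(Lx + s_P + 2)^{7 s_P + 2}` tests
  (the sharp form of the circuit count of `SizeClassCounting.lean`).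

## References

* S. Hirahara, *NP-hardness of learning programs and partial MCSP*, ECCC TR22-119, proof of
  Thm. 8.5 (`MCSP*` case, p. 31) and of Lemma 8.3 (pp. 28–30) [Hirahara2022PartialMCSP].
* S. Arora, B. Barak, *Computational Complexity: A Modern Approach*, CUP 2009, Thm. 6.21 (count of
  small circuits) [AroraBarakCC2009].
-/

namespace Literature.Computability.Complexity

open Finset
open _root_.Computability
open Literature.Computability.MetaComplexity (MonotoneDNF MCSPStar boolFunEquivFin)
open Literature.Computability.MetaComplexity.MonotoneDNF (BenalohLeichter.Rand BenalohLeichter.share)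
open Literature.Computability.Learning (CircuitCode GateCode)

namespace HiraharaRed

variable {n ℓ Δ dNW ν mm Lj : ℕ}

/-! ### The bit index as `Fin Lx` -/

/-- The number of index bits `Lx = Lj + (d + mm·Δ)`. [cite: Hirahara2022PartialMCSP, proof of Thm. 8.5 (|x| = O(log n))] -/
abbrev Lx (Lj dNW mm Δ : ℕ) : ℕ := Lj + (dNW + mm * Δ)

/-- `XB ≃ Fin Lx` by position. [folklore] -/
def eX (Lj dNW mm Δ : ℕ) : XB Lj dNW mm Δ ≃ Fin (Lx Lj dNW mm Δ) :=
  (Equiv.sumCongr (Equiv.refl _) ((Equiv.sumCongr (Equiv.refl _) finProdFinEquiv).trans finSumFinEquiv)).trans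
    finSumFinEquiv

/-- The index bits of a sample index as a vector on `Fin Lx`. [cite: Hirahara2022PartialMCSP, proof of Lemma 8.3] -/
def xvec (x : X ν dNW mm Δ) : Fin (Lx Lj dNW mm Δ) → Bool := fun i => xbits (Lj := Lj) x ((eX Lj dNW mm Δ).symm i)

/-- Reading `xvec` back through `eX`. [folklore] -/
@[simp] theorem xvec_eX (x : X ν dNW mm Δ) (w : XB Lj dNW mm Δ) :
    xvec (Lj := Lj) x (eX Lj dNW mm Δ w) = xbits (Lj := Lj) x w := by
  simp [xvec]

/-- The index bits are injective (for `ν ≤ 2^{Lj}`). [folklore] -/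
theorem xbits_injective (hν : ν ≤ 2 ^ Lj) : Function.Injective (xbits (Lj := Lj) : X ν dNW mm Δ → _) := by
  rintro ⟨j, z, ξ⟩ ⟨j', z', ξ'⟩ h
  have hj : jbits Lj j = jbits Lj j' := funext fun i => congrFun h (Sum.inl i)
  have hz : z = z' := funext fun q => congrFun h (Sum.inr (Sum.inl q))
  have hξ : ξ = ξ' := funext fun i => funext fun t => congrFun h (Sum.inr (Sum.inr (i, t)))
  rw [jbits_injective hν hj, hz, hξ]

/-- `xvec` is injective (for `ν ≤ 2^{Lj}`). [folklore] -/
theorem xvec_injective (hν : ν ≤ 2 ^ Lj) : Function.Injective (xvec (Lj := Lj) : X ν dNW mm Δ → _) := by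
  intro x x' h
  apply xbits_injective hν
  funext w
  have := congrFun h (eX Lj dNW mm Δ w)
  simpa using this

/-! ### The partial truth table -/

section Table

variable (E : Fin n × Fin Δ → (Fin ℓ ↪ Fin dNW)) (Fhat : Fin n → (Fin ℓ → Bool) → Bool)
  (φ : Fin ν → MonotoneDNF) (slot : Fin ν → Fin mm → Option (Fin n)) (Lj)

/-- **The partial truth table** of the sample: `b` at the bits of every point of secret `b`, `*`
(`none`) elsewhere. [cite: Hirahara2022PartialMCSP, proof of Thm. 8.5 (MCSP* case: f(x) := b if (x,b) ∈ supp(E_k), * otherwise)] -/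
noncomputable def PT (v : Fin (Lx Lj dNW mm Δ) → Bool) : Option Bool :=
  open scoped Classical in
  if h : ∃ b : Bool, ∃ (j : Fin ν) (z : Fin dNW → Bool) (r : BenalohLeichter.Rand (φ j)),
      v = xvec (Lj := Lj) (point E Fhat φ slot j z b r) then some (Classical.choose h) else none

/-- **The `MCSP*` instance** `(table, s_P)`. [cite: Hirahara2022PartialMCSP, proof of Thm. 8.5 (output (f, s_P))] -/
noncomputable def tableCode (sP : ℕ) : List Bool :=
  boolPair ((encodingBoolBool.optionBool).listBool.encode
    (List.ofFn fun i : Fin (2 ^ Lx Lj dNW mm Δ) => PT Lj E Fhat φ slot ((boolFunEquivFin _).symm i)))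
    (encodeNat sP)

variable {E Fhat φ slot Lj}

/-- A table entry `some b` comes from a point of secret `b`. [cite: Hirahara2022PartialMCSP, proof of Thm. 8.5] -/
theorem exists_point_of_PT_eq_some {v : Fin (Lx Lj dNW mm Δ) → Bool} {b : Bool}
    (h : PT Lj E Fhat φ slot v = some b) :
    ∃ (j : Fin ν) (z : Fin dNW → Bool) (r : BenalohLeichter.Rand (φ j)), v = xvec (Lj := Lj) (point E Fhat φ slot j z b r) := by
  classical
  unfold PT at h
  split_ifs at h with hex
  · have hb := Classical.choose_spec hex
    rw [Option.some.injEq] at h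
    rw [h] at hb
    exact hb
  
/-- **A point determines its secret** (decoding by the full coalition, Lemma 4.5 correctness).
[cite: Hirahara2022PartialMCSP, proof of Lemma 8.3 (footnote 23: no conflicting samples) with Lemma 4.5] -/
theorem secret_eq_of_point_eq (hφ : ∀ j, [] ∉ φ j) (hne : ∀ j, φ j ≠ []) (hdeg : ∀ j, (φ j).numLiterals ≤ Δ)
    (hslot : ∀ (j : Fin ν) (t : List ℕ), t ∈ φ j → ∀ v ∈ t, ∃ (k : Fin n) (i : Fin mm), k.val = v ∧ slot j i = some k)
    {j : Fin ν} {z : Fin dNW → Bool} {b b' : Bool} {r r' : BenalohLeichter.Rand (φ j)}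
    (h : point E Fhat φ slot j z b r = point E Fhat φ slot j z b' r') : b = b' := by
  classical
  -- the share vectors agree
  have hsv : (shareVec φ slot j b r : Fin mm → Fin Δ → Bool) = shareVec φ slot j b' r' := by
    have h2 := congrArg (fun x : X ν dNW mm Δ => x.2.2) h
    simp only [point] at h2
    funext i t
    have := congrFun (congrFun h2 i) t
    simp only [xorV] at this
    revert this
    cases readY slot j (realY E Fhat z) i t <;> cases shareVec φ slot j b r i t <;>
      cases shareVec φ slot j b' r' i t <;> simp
  -- the full coalition of the variables of `φ j` is authorized
  set Tn : Finset ℕ := ((φ j).flatMap id).toFinset with hTn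
  have hauth : Tn ∈ (φ j).accessStructure.authorized := by
    obtain ⟨t, ht⟩ := List.exists_mem_of_ne_nil _ (hne j)
    exact ⟨t, ht, fun v hv => by rw [hTn, List.mem_toFinset, List.mem_flatMap]; exact ⟨t, ht, hv⟩⟩
  -- both secrets are the XOR of the same share bits
  have key : ∀ (c : Bool) (rc : BenalohLeichter.Rand (φ j)), (shareVec φ slot j c rc : Fin mm → Fin Δ → Bool) = shareVec φ slot j b r →
      parityFin ((φ j).termLen (MonotoneDNF.BenalohLeichter.firstTerm (φ j) Tn))
        (fun p : Fin ((φ j).termLen (MonotoneDNF.BenalohLeichter.firstTerm (φ j) Tn)) =>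
          (BenalohLeichter.share (φ j) b r ((φ j).varAt (MonotoneDNF.BenalohLeichter.firstTerm (φ j) Tn, p))).getD
            (((φ j).occsOf ((φ j).varAt (MonotoneDNF.BenalohLeichter.firstTerm (φ j) Tn, p))).idxOf
              (MonotoneDNF.BenalohLeichter.firstTerm (φ j) Tn, (p : ℕ))) false) = c := by
    intro c rc hc
    rw [← parityFin_shareBits_eq (φ j) (hφ j) hauth c rc]
    congr 1
    funext p
    obtain ⟨hlt, hin⟩ := MonotoneDNF.BenalohLeichter.firstTerm_spec (φ j) hauth
    obtain ⟨t, ht, hvt⟩ := varAt_mem_of_lt (φ j) hlt p.isLt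
    obtain ⟨k, i, hkv, hsl⟩ := hslot j t ht _ hvt
    have hocc : (MonotoneDNF.BenalohLeichter.firstTerm (φ j) Tn, (p : ℕ)) ∈
        (φ j).occsOf ((φ j).varAt (MonotoneDNF.BenalohLeichter.firstTerm (φ j) Tn, (p : ℕ))) := by
      rw [MonotoneDNF.mem_occsOf]; exact ⟨⟨hlt, p.isLt⟩, rfl⟩
    have hρ : ((φ j).occsOf ((φ j).varAt (MonotoneDNF.BenalohLeichter.firstTerm (φ j) Tn, (p : ℕ)))).idxOf
        (MonotoneDNF.BenalohLeichter.firstTerm (φ j) Tn, (p : ℕ)) < Δ :=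
      lt_of_lt_of_le (List.idxOf_lt_length_of_mem hocc) ((MonotoneDNF.length_occsOf_le _ _).trans (hdeg j))
    -- both bits are the slot entry `(i, ρ)` of the share vector
    have hb1 := congrFun (congrFun hc i) ⟨_, hρ⟩
    simp only [shareVec, hsl] at hb1
    rw [hkv] at hb1
    exact hb1.symm
  rw [← key b r rfl, ← key b' r' hsv.symm]

/-- **The table is well defined**: at the bits of a point of secret `b` the entry is `b`.
[cite: Hirahara2022PartialMCSP, proof of Thm. 8.5 (MCSP* case) with footnote 23 of Lemma 8.3] -/
theorem PT_xvec_point (hν : ν ≤ 2 ^ Lj) (hφ : ∀ j, [] ∉ φ j) (hne : ∀ j, φ j ≠ [])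
    (hdeg : ∀ j, (φ j).numLiterals ≤ Δ)
    (hslot : ∀ (j : Fin ν) (t : List ℕ), t ∈ φ j → ∀ v ∈ t, ∃ (k : Fin n) (i : Fin mm), k.val = v ∧ slot j i = some k)
    (j : Fin ν) (z : Fin dNW → Bool) (b : Bool) (r : BenalohLeichter.Rand (φ j)) :
    PT Lj E Fhat φ slot (xvec (Lj := Lj) (point E Fhat φ slot j z b r)) = some b := by
  classical
  have hex : ∃ b₀ : Bool, ∃ (j₀ : Fin ν) (z₀ : Fin dNW → Bool) (r₀ : BenalohLeichter.Rand (φ j₀)),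
      xvec (Lj := Lj) (point E Fhat φ slot j z b r) = xvec (Lj := Lj) (point E Fhat φ slot j₀ z₀ b₀ r₀) :=
    ⟨b, j, z, r, rfl⟩
  unfold PT
  rw [dif_pos hex, Option.some.injEq]
  obtain ⟨j₀, z₀, r₀, h0⟩ := Classical.choose_spec hex
  have hx := xvec_injective hν h0
  -- same formula index
  have hj : j₀ = j := by
    have := congrArg (fun x : X ν dNW mm Δ => x.1) hx; exact this.symm
  subst hj
  have hz : z₀ = z := by
    have := congrArg (fun x : X ν dNW mm Δ => x.2.1) hx; exact this.symm
  subst hz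
  exact (secret_eq_of_point_eq hφ hne hdeg hslot hx).symm

end Table

/-! ### `MCSP*` membership of the table code -/

section Membership

variable {E : Fin n × Fin Δ → (Fin ℓ ↪ Fin dNW)} {Fhat : Fin n → (Fin ℓ → Bool) → Bool}
  {φ : Fin ν → MonotoneDNF} {slot : Fin ν → Fin mm → Option (Fin n)}

/-- **`tableCode ∈ MCSP*` iff a `B₂`-circuit with at most `s_P` gates answers the secret at every
sample point.** [cite: Hirahara2022PartialMCSP, proof of Thm. 8.5 (MCSP* case) and Def. of MCSP* (§1)] -/
theorem tableCode_mem_MCSPStar_iff (hν : ν ≤ 2 ^ Lj) (hφ : ∀ j, [] ∉ φ j) (hne : ∀ j, φ j ≠ [])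
    (hdeg : ∀ j, (φ j).numLiterals ≤ Δ)
    (hslot : ∀ (j : Fin ν) (t : List ℕ), t ∈ φ j → ∀ v ∈ t, ∃ (k : Fin n) (i : Fin mm), k.val = v ∧ slot j i = some k)
    (sP : ℕ) :
    tableCode Lj E Fhat φ slot sP ∈ MCSPStar ↔
      ∃ C : Circuit (Fin (Lx Lj dNW mm Δ)), C.IsOver B2 ∧ C.size ≤ sP ∧
        ∀ (j : Fin ν) (z : Fin dNW → Bool) (b : Bool) (r : BenalohLeichter.Rand (φ j)),
          C.eval (xvec (Lj := Lj) (point E Fhat φ slot j z b r)) = b := by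
  constructor
  · rintro ⟨m, T, s', hw, C, hC, hsize, hT⟩
    have h := congrArg boolUnpair hw
    simp only [tableCode, boolUnpair_boolPair, Prod.mk.injEq] at h
    obtain ⟨hfT, hs⟩ := h
    have hs' : sP = s' := by simpa using congrArg decodeNat hs
    subst hs'
    have hl := (encodingBoolBool.optionBool).listBool.encode_injective hfT
    have hlen := congrArg List.length hl
    simp only [List.length_ofFn] at hlen
    obtain rfl : Lx Lj dNW mm Δ = m := Nat.pow_right_injective le_rfl hlen
    have hT' : T = fun i => PT Lj E Fhat φ slot ((boolFunEquivFin _).symm i) := (List.ofFn_injective hl).symm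
    subst hT'
    refine ⟨C, hC, hsize, fun j z b r => ?_⟩
    have := hT (boolFunEquivFin _ (xvec (Lj := Lj) (point E Fhat φ slot j z b r))) b
      (by simpa using PT_xvec_point hν hφ hne hdeg hslot j z b r)
    simpa using this
  · rintro ⟨C, hC, hsize, hcons⟩
    refine ⟨_, _, sP, rfl, C, hC, hsize, ?_⟩
    intro i b hi
    obtain ⟨j, z, r, hv⟩ := exists_point_of_PT_eq_some hi
    rw [hv]
    exact hcons j z b r

end Membership

/-! ### The tests: functions of the sample index computed by small circuits -/

section Tests

/-- **Sharp count of circuit codes**: at most `(L + s + 2)^{7s+2}` codes of `B₂`-circuits with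
`≤ s` gates on `L` inputs. [cite: AroraBarakCC2009, Thm. 6.21 (proof, p. 116)] -/
theorem card_circuitCode_le_pow (L s : ℕ) : Fintype.card (CircuitCode L s) ≤ (L + s + 2) ^ (7 * s + 2) := by
  set M := L + s + 2 with hM
  have hG : Fintype.card (GateCode L s) ≤ M ^ 7 := Learning.card_gateCode_le L s
  have hsum : Fintype.card (Σ len : Fin (s + 1), List.Vector (GateCode L s) len) ≤ M * (M ^ 7) ^ s := by
    rw [Fintype.card_sigma]
    calc ∑ len : Fin (s + 1), Fintype.card (List.Vector (GateCode L s) len)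
        ≤ ∑ _len : Fin (s + 1), (M ^ 7) ^ s := Finset.sum_le_sum fun len _ => by
          rw [card_vector]
          calc Fintype.card (GateCode L s) ^ (len : ℕ) ≤ (M ^ 7) ^ (len : ℕ) := Nat.pow_le_pow_left hG _
            _ ≤ (M ^ 7) ^ s := Nat.pow_le_pow_right (by positivity) (Nat.lt_succ_iff.1 len.isLt)
      _ = (s + 1) * (M ^ 7) ^ s := by simp
      _ ≤ M * (M ^ 7) ^ s := Nat.mul_le_mul_right _ (by omega)
  have hout : Fintype.card (Fin L ⊕ Fin s) ≤ M := by
    simp only [Fintype.card_sum, Fintype.card_fin]; omega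
  calc Fintype.card (CircuitCode L s)
      = Fintype.card (Σ len : Fin (s + 1), List.Vector (GateCode L s) len) * Fintype.card (Fin L ⊕ Fin s) :=
        Fintype.card_prod _ _
    _ ≤ (M * (M ^ 7) ^ s) * M := Nat.mul_le_mul hsum hout
    _ = M ^ (7 * s + 2) := by rw [← pow_mul]; ring

variable (Lj)

/-- **The tests**: the functions of the sample index `X` computed (through the index bits) by the
codes of `B₂`-circuits with at most `s_P` gates. [cite: Hirahara2022PartialMCSP, proof of Lemma 8.3 (soundness: union over all programs M of size ≤ s)] -/
noncomputable def tests (ν dNW mm Δ sP : ℕ) : Finset (X ν dNW mm Δ → Bool) :=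
  open scoped Classical in
  (univ : Finset (CircuitCode (Lx Lj dNW mm Δ) sP)).image fun c x => c.toFun (xvec (Lj := Lj) x)

/-- There are at most `(Lx + s_P + 2)^{7 s_P + 2}` tests. [cite: AroraBarakCC2009, Thm. 6.21] -/
theorem card_tests_le (ν dNW mm Δ sP : ℕ) :
    (tests Lj ν dNW mm Δ sP).card ≤ (Lx Lj dNW mm Δ + sP + 2) ^ (7 * sP + 2) := by
  classical
  unfold tests
  exact card_image_le.trans (by rw [card_univ]; exact card_circuitCode_le_pow _ _)

/-- A small circuit on the index bits computes a test. [cite: AroraBarakCC2009, Thm. 6.21 (proof: every small circuit has a code)] -/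
theorem exists_mem_tests_of_circuit {sP : ℕ} (C : Circuit (Fin (Lx Lj dNW mm Δ))) (hC : C.IsOver B2) (hs : C.size ≤ sP) :
    ∃ g ∈ tests Lj ν dNW mm Δ sP, ∀ x : X ν dNW mm Δ, g x = C.eval (xvec (Lj := Lj) x) := by
  classical
  have hmem : (fun v => C.eval v) ∈ Learning.sizeClass B2 (fun _ => sP) (Lx Lj dNW mm Δ) :=
    ⟨C, hC, fun _ => rfl, hs⟩
  obtain ⟨c, hc⟩ := Learning.sizeClass_subset_range (fun _ => sP) _ hmem
  refine ⟨fun x => c.toFun (xvec (Lj := Lj) x), ?_, fun x => by rw [hc]⟩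
  unfold tests
  exact mem_image.2 ⟨c, mem_univ _, rfl⟩

end Tests

end HiraharaRed

end Literature.Computability.Complexity
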